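import Literature.Barriers.CriticalPhenomena.PlaquetteWalkFacePath
import Literature.Barriers.CriticalPhenomena.PlaquetteWalkHoleRootRowLawWitness
import HarnessLib

/-!
# Barrier catalogue (SAWScalingLimit): the PARAMETRIC root-row witnesses — the ROOT-ROW LAW at EVERY cell of the root row east of the root («ROW LAW, EVERY CELL»)

`Z → ∞` limit model of the printed Yang–Baxter weights [GlazmanManolescu2019, §1, eq. (1)]; the «RECTANGLE COEFFICIENT» line of the venture lane «pcv-sawmu»
(b-engine-1 g27). `PlaquetteWalkHoleRootRowLawWitness` decides the census member 'ao' one cell at a time (`k ≤ 3`). Here it is written as a FACE PATH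
(`PlaquetteWalkFacePath.YBWalk.ofFacePath`) for ALL `k ≥ 0`: from the root `(4,2).side W` east along the root row into `r = (4+k, 2)` (straight, first hit `k`),
out through `N`, `S→W` in `(4+k, 3)`, west along row `3` to `(2,3)` (`E→S`), straight down through `(2,2)`, `N→E` in `(2,1)`, east along row `1` to `(4+k, 1)`,
`W→N` back into `r` through its `S` side: `3k + 8` arcs in pairwise distinct faces, five of them turning (limit cost `5` at slot `S`), ONE mid-edge (the last,
`slant (4+k) 2`) on the eastern ray of the hole (odd ray count ⇒ wound), first hit `k`, no later arc in `r` (class `B2a`). With the transport of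
`PlaquetteWalkHoleRootRowLawWitness`: ★★★★★ `vertexFunctional_printed_exists_ne_zero_of_rowFrame` — for EVERY `k ≥ 0` and every finite face list containing the
frame `rowFrame w k` and missing the hole, the printed vertex functional at `(w.1 + k, w.2)` is not identically zero on `(0, π)`: the sufficiency half of the
lane's (S5) on the root row. [GlazmanManolescu2019 §1 Fig. 1, eq. (1), §4.2, Lemma 2.1, Remark 2.2; Glazman2015WeightedSAW Lemma 3.1 (proof, pp. 6–7);
CourantRobbins1958 Ch. V App. §2]
-/

noncomputable section

open Set Function Complex

namespace Literature.Barriers.CriticalPhenomena.PlaquetteWalk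

open Literature.Probability.RandomPlanarGeometry.SAW.YangBaxter
open Real Complex

/-! ## §1 The face path of the root-row witness `k` at the reference root `(4,2)` -/

section Reference

variable (k : ℕ)

/-- The faces of the root-row witness `k`, in order (`3k + 8` of them): root row `(4..4+k, 2)`, `(4+k, 3)`, row `(3+k..2, 3)`, `(2,2)`, `(2,1)`, row `(3..4+k, 1)`.
[cite: GlazmanManolescu2019, §1 (definition of the model), Fig. 1] -/
def rowFace (i : ℕ) : Face :=
  if i ≤ k then ((4 : ℤ) + i, 2)
  else if i ≤ k + 1 then ((4 : ℤ) + k, 3)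
  else if i ≤ 2 * k + 3 then ((5 : ℤ) + 2 * k - i, 3)
  else if i ≤ 2 * k + 4 then ((2 : ℤ), 2)
  else if i ≤ 2 * k + 5 then ((2 : ℤ), 1)
  else ((i : ℤ) - 2 * k - 3, 1)

/-- The entry sides of the root-row witness `k`. [cite: GlazmanManolescu2019, §1 (definition of the model), Fig. 2] -/
def rowIn (i : ℕ) : Side :=
  if i ≤ k then .W
  else if i ≤ k + 1 then .S
  else if i ≤ 2 * k + 3 then .E
  else if i ≤ 2 * k + 4 then .N
  else if i ≤ 2 * k + 5 then .N
  else .W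

/-- The exit sides of the root-row witness `k` (each run ends with its turn). [cite: GlazmanManolescu2019, §1 (definition of the model), Fig. 2] -/
def rowOut (i : ℕ) : Side :=
  if i < k then .E
  else if i = k then .N
  else if i = k + 1 then .W
  else if i < 2 * k + 3 then .W
  else if i = 2 * k + 3 then .S
  else if i = 2 * k + 4 then .S
  else if i = 2 * k + 5 then .E
  else if i < 3 * k + 7 then .E
  else .N

/-- The reference frame of the root-row witness `k`: its faces, listed along the path. [cite: GlazmanManolescu2019, §2.1 (finite domains of faces)] -/
def rowFrame42 : List Face := (List.range (3 * k + 8)).map (rowFace k)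

variable {k}

/-! ### Piece lemmas (the `if`-chains evaluated on each run and corner) -/

/-- The faces on piece `A`. [cite: GlazmanManolescu2019, §1 (definition of the model)] -/
theorem rowFace_A {i : ℕ} (h : i ≤ k) : rowFace k i = ((4 : ℤ) + i, 2) := by
  unfold rowFace
  rw [if_pos (show i ≤ k by omega)]

/-- The entry sides on piece `A`. [cite: GlazmanManolescu2019, §1 (definition of the model)] -/
theorem rowIn_A {i : ℕ} (h : i ≤ k) : rowIn k i = .W := by
  unfold rowIn
  rw [if_pos (show i ≤ k by omega)]

/-- The faces on piece `B`. [cite: GlazmanManolescu2019, §1 (definition of the model)] -/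
theorem rowFace_B {i : ℕ} (h1 : k < i) (h2 : i ≤ k + 1) : rowFace k i = ((4 : ℤ) + k, 3) := by
  unfold rowFace
  rw [if_neg (show ¬(i ≤ k) by omega), if_pos (show i ≤ k + 1 by omega)]

/-- The entry sides on piece `B`. [cite: GlazmanManolescu2019, §1 (definition of the model)] -/
theorem rowIn_B {i : ℕ} (h1 : k < i) (h2 : i ≤ k + 1) : rowIn k i = .S := by
  unfold rowIn
  rw [if_neg (show ¬(i ≤ k) by omega), if_pos (show i ≤ k + 1 by omega)]

/-- The faces on piece `C`. [cite: GlazmanManolescu2019, §1 (definition of the model)] -/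
theorem rowFace_C {i : ℕ} (h1 : k + 1 < i) (h2 : i ≤ 2 * k + 3) : rowFace k i = ((5 : ℤ) + 2 * k - i, 3) := by
  unfold rowFace
  rw [if_neg (show ¬(i ≤ k) by omega), if_neg (show ¬(i ≤ k + 1) by omega), if_pos (show i ≤ 2 * k + 3 by omega)]

/-- The entry sides on piece `C`. [cite: GlazmanManolescu2019, §1 (definition of the model)] -/
theorem rowIn_C {i : ℕ} (h1 : k + 1 < i) (h2 : i ≤ 2 * k + 3) : rowIn k i = .E := by
  unfold rowIn
  rw [if_neg (show ¬(i ≤ k) by omega), if_neg (show ¬(i ≤ k + 1) by omega), if_pos (show i ≤ 2 * k + 3 by omega)]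

/-- The faces on piece `D`. [cite: GlazmanManolescu2019, §1 (definition of the model)] -/
theorem rowFace_D {i : ℕ} (h1 : 2 * k + 3 < i) (h2 : i ≤ 2 * k + 4) : rowFace k i = ((2 : ℤ), 2) := by
  unfold rowFace
  rw [if_neg (show ¬(i ≤ k) by omega), if_neg (show ¬(i ≤ k + 1) by omega), if_neg (show ¬(i ≤ 2 * k + 3) by omega), if_pos (show i ≤ 2 * k + 4 by omega)]

/-- The entry sides on piece `D`. [cite: GlazmanManolescu2019, §1 (definition of the model)] -/
theorem rowIn_D {i : ℕ} (h1 : 2 * k + 3 < i) (h2 : i ≤ 2 * k + 4) : rowIn k i = .N := by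
  unfold rowIn
  rw [if_neg (show ¬(i ≤ k) by omega), if_neg (show ¬(i ≤ k + 1) by omega), if_neg (show ¬(i ≤ 2 * k + 3) by omega), if_pos (show i ≤ 2 * k + 4 by omega)]

/-- The faces on piece `E`. [cite: GlazmanManolescu2019, §1 (definition of the model)] -/
theorem rowFace_E {i : ℕ} (h1 : 2 * k + 4 < i) (h2 : i ≤ 2 * k + 5) : rowFace k i = ((2 : ℤ), 1) := by
  unfold rowFace
  rw [if_neg (show ¬(i ≤ k) by omega), if_neg (show ¬(i ≤ k + 1) by omega), if_neg (show ¬(i ≤ 2 * k + 3) by omega), if_neg (show ¬(i ≤ 2 * k + 4) by omega), if_pos (show i ≤ 2 * k + 5 by omega)]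

/-- The entry sides on piece `E`. [cite: GlazmanManolescu2019, §1 (definition of the model)] -/
theorem rowIn_E {i : ℕ} (h1 : 2 * k + 4 < i) (h2 : i ≤ 2 * k + 5) : rowIn k i = .N := by
  unfold rowIn
  rw [if_neg (show ¬(i ≤ k) by omega), if_neg (show ¬(i ≤ k + 1) by omega), if_neg (show ¬(i ≤ 2 * k + 3) by omega), if_neg (show ¬(i ≤ 2 * k + 4) by omega), if_pos (show i ≤ 2 * k + 5 by omega)]

/-- The faces on piece `F`. [cite: GlazmanManolescu2019, §1 (definition of the model)] -/
theorem rowFace_F {i : ℕ} (h1 : 2 * k + 5 < i) : rowFace k i = ((i : ℤ) - 2 * k - 3, 1) := by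
  unfold rowFace
  rw [if_neg (show ¬(i ≤ k) by omega), if_neg (show ¬(i ≤ k + 1) by omega), if_neg (show ¬(i ≤ 2 * k + 3) by omega), if_neg (show ¬(i ≤ 2 * k + 4) by omega), if_neg (show ¬(i ≤ 2 * k + 5) by omega)]

/-- The entry sides on piece `F`. [cite: GlazmanManolescu2019, §1 (definition of the model)] -/
theorem rowIn_F {i : ℕ} (h1 : 2 * k + 5 < i) : rowIn k i = .W := by
  unfold rowIn
  rw [if_neg (show ¬(i ≤ k) by omega), if_neg (show ¬(i ≤ k + 1) by omega), if_neg (show ¬(i ≤ 2 * k + 3) by omega), if_neg (show ¬(i ≤ 2 * k + 4) by omega), if_neg (show ¬(i ≤ 2 * k + 5) by omega)]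

/-- The exit sides on piece `A0`. [cite: GlazmanManolescu2019, §1 (definition of the model)] -/
theorem rowOut_A0 {i : ℕ} (h : i < k) : rowOut k i = .E := by
  unfold rowOut
  rw [if_pos (show i < k by omega)]

/-- The exit sides on piece `A1`. [cite: GlazmanManolescu2019, §1 (definition of the model)] -/
theorem rowOut_A1 {i : ℕ} (h1 : k ≤ i) (h2 : i ≤ k) : rowOut k i = .N := by
  unfold rowOut
  rw [if_neg (show ¬(i < k) by omega), if_pos (show i = k by omega)]

/-- The exit sides on piece `B0`. [cite: GlazmanManolescu2019, §1 (definition of the model)] -/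
theorem rowOut_B0 {i : ℕ} (h1 : k + 1 ≤ i) (h2 : i ≤ k + 1) : rowOut k i = .W := by
  unfold rowOut
  rw [if_neg (show ¬(i < k) by omega), if_neg (show ¬(i = k) by omega), if_pos (show i = k + 1 by omega)]

/-- The exit sides on piece `C0`. [cite: GlazmanManolescu2019, §1 (definition of the model)] -/
theorem rowOut_C0 {i : ℕ} (h1 : k + 1 < i) (h2 : i < 2 * k + 3) : rowOut k i = .W := by
  unfold rowOut
  rw [if_neg (show ¬(i < k) by omega), if_neg (show ¬(i = k) by omega), if_neg (show ¬(i = k + 1) by omega), if_pos (show i < 2 * k + 3 by omega)]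

/-- The exit sides on piece `C1`. [cite: GlazmanManolescu2019, §1 (definition of the model)] -/
theorem rowOut_C1 {i : ℕ} (h1 : 2 * k + 3 ≤ i) (h2 : i ≤ 2 * k + 3) : rowOut k i = .S := by
  unfold rowOut
  rw [if_neg (show ¬(i < k) by omega), if_neg (show ¬(i = k) by omega), if_neg (show ¬(i = k + 1) by omega), if_neg (show ¬(i < 2 * k + 3) by omega), if_pos (show i = 2 * k + 3 by omega)]

/-- The exit sides on piece `D0`. [cite: GlazmanManolescu2019, §1 (definition of the model)] -/
theorem rowOut_D0 {i : ℕ} (h1 : 2 * k + 4 ≤ i) (h2 : i ≤ 2 * k + 4) : rowOut k i = .S := by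
  unfold rowOut
  rw [if_neg (show ¬(i < k) by omega), if_neg (show ¬(i = k) by omega), if_neg (show ¬(i = k + 1) by omega), if_neg (show ¬(i < 2 * k + 3) by omega), if_neg (show ¬(i = 2 * k + 3) by omega), if_pos (show i = 2 * k + 4 by omega)]

/-- The exit sides on piece `E0`. [cite: GlazmanManolescu2019, §1 (definition of the model)] -/
theorem rowOut_E0 {i : ℕ} (h1 : 2 * k + 5 ≤ i) (h2 : i ≤ 2 * k + 5) : rowOut k i = .E := by
  unfold rowOut
  rw [if_neg (show ¬(i < k) by omega), if_neg (show ¬(i = k) by omega), if_neg (show ¬(i = k + 1) by omega), if_neg (show ¬(i < 2 * k + 3) by omega), if_neg (show ¬(i = 2 * k + 3) by omega), if_neg (show ¬(i = 2 * k + 4) by omega), if_pos (show i = 2 * k + 5 by omega)]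

/-- The exit sides on piece `F0`. [cite: GlazmanManolescu2019, §1 (definition of the model)] -/
theorem rowOut_F0 {i : ℕ} (h1 : 2 * k + 5 < i) (h2 : i < 3 * k + 7) : rowOut k i = .E := by
  unfold rowOut
  rw [if_neg (show ¬(i < k) by omega), if_neg (show ¬(i = k) by omega), if_neg (show ¬(i = k + 1) by omega), if_neg (show ¬(i < 2 * k + 3) by omega), if_neg (show ¬(i = 2 * k + 3) by omega), if_neg (show ¬(i = 2 * k + 4) by omega), if_neg (show ¬(i = 2 * k + 5) by omega), if_pos (show i < 3 * k + 7 by omega)]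

/-- The exit sides on piece `F1`. [cite: GlazmanManolescu2019, §1 (definition of the model)] -/
theorem rowOut_F1 {i : ℕ} (h1 : 3 * k + 7 ≤ i) : rowOut k i = .N := by
  unfold rowOut
  rw [if_neg (show ¬(i < k) by omega), if_neg (show ¬(i = k) by omega), if_neg (show ¬(i = k + 1) by omega), if_neg (show ¬(i < 2 * k + 3) by omega), if_neg (show ¬(i = 2 * k + 3) by omega), if_neg (show ¬(i = 2 * k + 4) by omega), if_neg (show ¬(i = 2 * k + 5) by omega), if_neg (show ¬(i < 3 * k + 7) by omega)]

/-- Every index lies on one of the nine runs and corners. [cite: GlazmanManolescu2019, §1 (definition of the model)] -/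
theorem rowPieces {i : ℕ} (hi : i < 3 * k + 8) :
    i < k ∨ i = k ∨ i = k + 1 ∨ (k + 1 < i ∧ i < 2 * k + 3) ∨ i = 2 * k + 3 ∨ i = 2 * k + 4 ∨ i = 2 * k + 5 ∨ (2 * k + 5 < i ∧ i < 3 * k + 7) ∨
      i = 3 * k + 7 := by
  omega

/-- Every index lies on one of the six runs (corner included). [cite: GlazmanManolescu2019, §1 (definition of the model)] -/
theorem rowPieces6 (i : ℕ) :
    i ≤ k ∨ (k < i ∧ i ≤ k + 1) ∨ (k + 1 < i ∧ i ≤ 2 * k + 3) ∨ (2 * k + 3 < i ∧ i ≤ 2 * k + 4) ∨ (2 * k + 4 < i ∧ i ≤ 2 * k + 5) ∨ 2 * k + 5 < i := by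
  omega

/-! ### The obligations of the face-path constructor -/

/-- The faces are pairwise distinct. [cite: GlazmanManolescu2019, §1, Fig. 1] -/
theorem rowFace_injective : ∀ i j, i < 3 * k + 8 → j < 3 * k + 8 → rowFace k i = rowFace k j → i = j := by
  intro i j hi hj h
  rcases rowPieces6 (k := k) i with hi' | ⟨hi1, hi2⟩ | ⟨hi1, hi2⟩ | ⟨hi1, hi2⟩ | ⟨hi1, hi2⟩ | hi1 <;>
  [rw [rowFace_A hi'] at h; rw [rowFace_B hi1 hi2] at h; rw [rowFace_C hi1 hi2] at h; rw [rowFace_D hi1 hi2] at h;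
    rw [rowFace_E hi1 hi2] at h; rw [rowFace_F hi1] at h] <;>
  rcases rowPieces6 (k := k) j with hj' | ⟨hj1, hj2⟩ | ⟨hj1, hj2⟩ | ⟨hj1, hj2⟩ | ⟨hj1, hj2⟩ | hj1 <;>
  [rw [rowFace_A hj'] at h; rw [rowFace_B hj1 hj2] at h; rw [rowFace_C hj1 hj2] at h; rw [rowFace_D hj1 hj2] at h;
    rw [rowFace_E hj1 hj2] at h; rw [rowFace_F hj1] at h;
   rw [rowFace_A hj'] at h; rw [rowFace_B hj1 hj2] at h; rw [rowFace_C hj1 hj2] at h; rw [rowFace_D hj1 hj2] at h;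
    rw [rowFace_E hj1 hj2] at h; rw [rowFace_F hj1] at h;
   rw [rowFace_A hj'] at h; rw [rowFace_B hj1 hj2] at h; rw [rowFace_C hj1 hj2] at h; rw [rowFace_D hj1 hj2] at h;
    rw [rowFace_E hj1 hj2] at h; rw [rowFace_F hj1] at h;
   rw [rowFace_A hj'] at h; rw [rowFace_B hj1 hj2] at h; rw [rowFace_C hj1 hj2] at h; rw [rowFace_D hj1 hj2] at h;
    rw [rowFace_E hj1 hj2] at h; rw [rowFace_F hj1] at h;
   rw [rowFace_A hj'] at h; rw [rowFace_B hj1 hj2] at h; rw [rowFace_C hj1 hj2] at h; rw [rowFace_D hj1 hj2] at h;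
    rw [rowFace_E hj1 hj2] at h; rw [rowFace_F hj1] at h;
   rw [rowFace_A hj'] at h; rw [rowFace_B hj1 hj2] at h; rw [rowFace_C hj1 hj2] at h; rw [rowFace_D hj1 hj2] at h;
    rw [rowFace_E hj1 hj2] at h; rw [rowFace_F hj1] at h] <;>
  (simp only [Prod.mk.injEq] at h; omega)

/-- Entry and exit sides differ. [cite: GlazmanManolescu2019, §1 (definition of the model)] -/
theorem rowIn_ne_rowOut : ∀ i < 3 * k + 8, rowIn k i ≠ rowOut k i := by
  intro i hi
  rcases rowPieces hi with h | h | h | ⟨h1, h2⟩ | h | h | h | ⟨h1, h2⟩ | h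
  · rw [rowIn_A h.le, rowOut_A0 h]; decide
  · rw [rowIn_A h.le, rowOut_A1 h.ge h.le]; decide
  · rw [rowIn_B (by omega) h.le, rowOut_B0 h.ge h.le]; decide
  · rw [rowIn_C h1 h2.le, rowOut_C0 h1 h2]; decide
  · rw [rowIn_C (by omega) h.le, rowOut_C1 h.ge h.le]; decide
  · rw [rowIn_D (by omega) h.le, rowOut_D0 h.ge h.le]; decide
  · rw [rowIn_E (by omega) h.le, rowOut_E0 h.ge h.le]; decide
  · rw [rowIn_F h1, rowOut_F0 h1 h2]; decide
  · rw [rowIn_F (k := k) (i := i) (by omega), rowOut_F1 (k := k) (i := i) (by omega)]; decide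

/-- Consecutive faces are glued along the crossed mid-edge. [cite: GlazmanManolescu2019, §1 (definition of the model)] -/
theorem rowFace_glue : ∀ i, i + 1 < 3 * k + 8 → (rowFace k i).side (rowOut k i) = (rowFace k (i + 1)).side (rowIn k (i + 1)) := by
  intro i hi
  rcases rowPieces (show i < 3 * k + 8 by omega) with h | h | h | ⟨h1, h2⟩ | h | h | h | ⟨h1, h2⟩ | h
  · rw [rowFace_A h.le, rowOut_A0 h, rowFace_A (k := k) (i := i + 1) (by omega), rowIn_A (k := k) (i := i + 1) (by omega)]
    simp only [Face.side, MidEdge.vert.injEq, and_true]; omega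
  · rw [rowFace_A h.le, rowOut_A1 h.ge h.le, rowFace_B (k := k) (i := i + 1) (by omega) (by omega), rowIn_B (k := k) (i := i + 1) (by omega) (by omega)]
    simp only [Face.side, MidEdge.slant.injEq]; omega
  · rw [rowFace_B (by omega) h.le, rowOut_B0 h.ge h.le, rowFace_C (k := k) (i := i + 1) (by omega) (by omega),
      rowIn_C (k := k) (i := i + 1) (by omega) (by omega)]
    simp only [Face.side, MidEdge.vert.injEq, and_true]; omega
  · rw [rowFace_C h1 h2.le, rowOut_C0 h1 h2, rowFace_C (k := k) (i := i + 1) (by omega) (by omega), rowIn_C (k := k) (i := i + 1) (by omega) (by omega)]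
    simp only [Face.side, MidEdge.vert.injEq, and_true]; omega
  · rw [rowFace_C (by omega) h.le, rowOut_C1 h.ge h.le, rowFace_D (k := k) (i := i + 1) (by omega) (by omega),
      rowIn_D (k := k) (i := i + 1) (by omega) (by omega)]
    simp only [Face.side, MidEdge.slant.injEq]; omega
  · rw [rowFace_D (by omega) h.le, rowOut_D0 h.ge h.le, rowFace_E (k := k) (i := i + 1) (by omega) (by omega),
      rowIn_E (k := k) (i := i + 1) (by omega) (by omega)]
    simp only [Face.side, MidEdge.slant.injEq, true_and]; omega
  · rw [rowFace_E (by omega) h.le, rowOut_E0 h.ge h.le, rowFace_F (k := k) (i := i + 1) (by omega), rowIn_F (k := k) (i := i + 1) (by omega)]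
    simp only [Face.side, MidEdge.vert.injEq, and_true]; omega
  · rw [rowFace_F h1, rowOut_F0 h1 h2, rowFace_F (k := k) (i := i + 1) (by omega), rowIn_F (k := k) (i := i + 1) (by omega)]
    simp only [Face.side, MidEdge.vert.injEq, and_true]; omega
  · exfalso; omega

/-- No exit mid-edge is the root mid-edge `(4,2).side W`. [cite: GlazmanManolescu2019, §1 (the lattice of rhombi and its mid-edges)] -/
theorem rowExit_ne_root : ∀ j < 3 * k + 8, (rowFace k j).side (rowOut k j) ≠ (rowFace k 0).side (rowIn k 0) := by
  intro i hi
  rw [rowFace_A (Nat.zero_le _), rowIn_A (Nat.zero_le _)]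
  rcases rowPieces hi with h | h | h | ⟨h1, h2⟩ | h | h | h | ⟨h1, h2⟩ | h
  · rw [rowFace_A h.le, rowOut_A0 h]; simp only [Face.side, ne_eq, MidEdge.vert.injEq]; omega
  · rw [rowFace_A h.le, rowOut_A1 h.ge h.le]; simp [Face.side]
  · rw [rowFace_B (by omega) h.le, rowOut_B0 h.ge h.le]; simp only [Face.side, ne_eq, MidEdge.vert.injEq]; omega
  · rw [rowFace_C h1 h2.le, rowOut_C0 h1 h2]; simp only [Face.side, ne_eq, MidEdge.vert.injEq]; omega
  · rw [rowFace_C (by omega) h.le, rowOut_C1 h.ge h.le]; simp [Face.side]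
  · rw [rowFace_D (by omega) h.le, rowOut_D0 h.ge h.le]; simp [Face.side]
  · rw [rowFace_E (by omega) h.le, rowOut_E0 h.ge h.le]; simp only [Face.side, ne_eq, MidEdge.vert.injEq]; omega
  · rw [rowFace_F h1, rowOut_F0 h1 h2]; simp only [Face.side, ne_eq, MidEdge.vert.injEq]; omega
  · rw [rowFace_F (k := k) (i := i) (by omega), rowOut_F1 (k := k) (i := i) (by omega)]; simp [Face.side]

/-- The faces lie in the frame. [cite: GlazmanManolescu2019, §2.1 (finite domains of faces)] -/
theorem rowFace_mem : ∀ i < 3 * k + 8, rowFace k i ∈ dom (rowFrame42 k) := fun i hi =>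
  List.mem_map.2 ⟨i, List.mem_range.2 hi, rfl⟩

/-- The face path starts at the root mid-edge `(4,2).side W`. [cite: GlazmanManolescu2019, §1 (definition of the model)] -/
theorem rowPath_start : YBWalk.pathMid (rowFace k) (rowIn k) (rowOut k) 0 = w42.side .W := by
  rw [YBWalk.pathMid_zero, rowFace_A (Nat.zero_le _), rowIn_A (Nat.zero_le _)]; simp [Face.side, w42]

/-- The face path ends on the `S` side of `r = (4+k, 2)`. [cite: GlazmanManolescu2019, §1 (definition of the model)] -/
theorem rowPath_end : YBWalk.pathMid (rowFace k) (rowIn k) (rowOut k) (3 * k + 8) = Face.side (((4 : ℤ) + k, (2 : ℤ)) : Face) .S := by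
  rw [YBWalk.pathMid_succ, rowFace_F (k := k) (i := 3 * k + 7) (by omega), rowOut_F1 (k := k) (i := 3 * k + 7) (by omega)]
  simp only [Face.side, MidEdge.slant.injEq]; omega

/-- ★ **THE PARAMETRIC ROOT-ROW WITNESS** `k` (the census member 'ao' at `(4+k, 2)`), as a walk of its frame from the root `(4,2).side W` to the `S` side of `r`.
[cite: GlazmanManolescu2019, §1 (definition of the model), Fig. 1] -/
def rowWalkP (k : ℕ) : YBWalk (dom (rowFrame42 k)) (w42.side .W) (Face.side (((4 : ℤ) + k, (2 : ℤ)) : Face) .S) :=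
  (YBWalk.ofFacePath (3 * k + 8) (rowFace k) (rowIn k) (rowOut k) rowIn_ne_rowOut rowFace_glue rowFace_injective rowFace_mem rowExit_ne_root).cast
    rowPath_start rowPath_end

/-- The labelled parametric root-row witness (returns to the `S` side). [cite: Glazman2015WeightedSAW, Lemma 3.1 (proof, pp. 6–7: the classes of walks through a rhombus)] -/
def ωRP (k : ℕ) : ΩG (dom (rowFrame42 k)) (w42.side .W) (((4 : ℤ) + k, (2 : ℤ)) : Face) := ⟨.S, rowWalkP k⟩

/-! ## §2 Certificates of the parametric witness -/

/-- `nth` of the parametric witness. [cite: GlazmanManolescu2019, §1 (definition of the model)] -/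
theorem rowWalkP_nth {i : ℕ} (hi : i ≤ 3 * k + 8) : (rowWalkP k).nth i = YBWalk.pathMid (rowFace k) (rowIn k) (rowOut k) i := by
  unfold rowWalkP; rw [YBWalk.cast_nth, YBWalk.ofFacePath_nth _ _ _ _ _ hi]

/-- The parametric witness has `3k + 8` arcs. [cite: GlazmanManolescu2019, §1 (definition of the model)] -/
theorem rowWalkP_length : (rowWalkP k).arcs.length = 3 * k + 8 := by
  unfold rowWalkP; rw [YBWalk.cast_arcs, YBWalk.ofFacePath_length]

/-- Plaquettes and sides of the parametric witness. [cite: GlazmanManolescu2019, §1, Fig. 1 and Fig. 2] -/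
theorem rowWalkP_fc_sIn_sOut {i : ℕ} (hi : i < 3 * k + 8) :
    (rowWalkP k).fc i = rowFace k i ∧ (rowWalkP k).sIn i = rowIn k i ∧ (rowWalkP k).sOut i = rowOut k i := by
  unfold rowWalkP
  obtain ⟨e1, e2, e3⟩ := YBWalk.cast_fc_sIn_sOut (YBWalk.ofFacePath (3 * k + 8) (rowFace k) (rowIn k) (rowOut k) rowIn_ne_rowOut rowFace_glue
    rowFace_injective rowFace_mem rowExit_ne_root) rowPath_start rowPath_end i
  rw [e1, e2, e3]
  exact YBWalk.ofFacePath_fc_sIn_sOut _ _ _ _ _ hi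

/-- The turning arcs of the parametric witness are the five corners. [cite: GlazmanManolescu2019, §1, Fig. 1] -/
theorem rowTurn_iff {i : ℕ} (hi : i < 3 * k + 8) :
    arcKind (rowIn k i) (rowOut k i) ≠ .straight ↔ (i = k ∨ i = k + 1 ∨ i = 2 * k + 3 ∨ i = 2 * k + 5 ∨ i = 3 * k + 7) := by
  rcases rowPieces hi with h | h | h | ⟨h1, h2⟩ | h | h | h | ⟨h1, h2⟩ | h
  · rw [rowIn_A h.le, rowOut_A0 h]; exact iff_of_false (by decide) (by omega)
  · rw [rowIn_A h.le, rowOut_A1 h.ge h.le]; exact iff_of_true (by decide) (by omega)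
  · rw [rowIn_B (by omega) h.le, rowOut_B0 h.ge h.le]; exact iff_of_true (by decide) (by omega)
  · rw [rowIn_C h1 h2.le, rowOut_C0 h1 h2]; exact iff_of_false (by decide) (by omega)
  · rw [rowIn_C (by omega) h.le, rowOut_C1 h.ge h.le]; exact iff_of_true (by decide) (by omega)
  · rw [rowIn_D (by omega) h.le, rowOut_D0 h.ge h.le]; exact iff_of_false (by decide) (by omega)
  · rw [rowIn_E (by omega) h.le, rowOut_E0 h.ge h.le]; exact iff_of_true (by decide) (by omega)
  · rw [rowIn_F h1, rowOut_F0 h1 h2]; exact iff_of_false (by decide) (by omega)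
  · rw [rowIn_F (k := k) (i := i) (by omega), rowOut_F1 (k := k) (i := i) (by omega)]; exact iff_of_true (by decide) (by omega)

/-- The five corners, as the filtered index set. [cite: GlazmanManolescu2019, §1, Fig. 1] -/
theorem rowTurn_card : ((Finset.range (3 * k + 8)).filter fun i => arcKind (rowIn k i) (rowOut k i) ≠ .straight).card = 5 := by
  have e : ((Finset.range (3 * k + 8)).filter fun i => arcKind (rowIn k i) (rowOut k i) ≠ .straight) =
      {k, k + 1, 2 * k + 3, 2 * k + 5, 3 * k + 7} := by
    ext i
    simp only [Finset.mem_filter, Finset.mem_range, Finset.mem_insert, Finset.mem_singleton]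
    constructor
    · rintro ⟨hi, h⟩; exact (rowTurn_iff hi).1 h
    · intro h
      have hi : i < 3 * k + 8 := by omega
      exact ⟨hi, (rowTurn_iff hi).2 h⟩
  rw [e, Finset.card_insert_of_notMem ?_, Finset.card_insert_of_notMem ?_, Finset.card_insert_of_notMem ?_, Finset.card_insert_of_notMem ?_,
    Finset.card_singleton]
  all_goals simp only [Finset.mem_insert, Finset.mem_singleton]; omega

/-- ★ **LIMIT COST `5`** of the parametric witness (slot `S`): five turning arcs, no doubly visited plaquette. [cite: GlazmanManolescu2019, §1, eq. (1); Remark 2.2] -/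
theorem cost_rowWalkP : cost (slotOfSide .S) (rowWalkP k).mids = 5 := by
  unfold rowWalkP
  rw [YBWalk.cast_mids, YBWalk.cost_ofFacePath, YBWalk.countP_range_eq_card, rowTurn_card]
  decide

/-- Which exit mid-edges lie on the eastern ray of the hole: only the last one, the `S` side of `r`. [cite: CourantRobbins1958, Ch. V Appendix §2 (the even–odd rule: the ray)] -/
theorem rowRay_iff {m : ℕ} (hm : m < 3 * k + 8) : eastRayB w42 ((rowFace k m).side (rowOut k m)) = true ↔ m = 3 * k + 7 := by
  rcases rowPieces hm with h | h | h | ⟨h1, h2⟩ | h | h | h | ⟨h1, h2⟩ | h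
  · rw [rowFace_A h.le, rowOut_A0 h]; simp only [Face.side, eastRayB, Bool.false_eq_true, false_iff]; omega
  · rw [rowFace_A h.le, rowOut_A1 h.ge h.le]; simp only [Face.side, eastRayB, w42, decide_eq_true_eq]; omega
  · rw [rowFace_B (by omega) h.le, rowOut_B0 h.ge h.le]; simp only [Face.side, eastRayB, Bool.false_eq_true, false_iff]; omega
  · rw [rowFace_C h1 h2.le, rowOut_C0 h1 h2]; simp only [Face.side, eastRayB, Bool.false_eq_true, false_iff]; omega
  · rw [rowFace_C (by omega) h.le, rowOut_C1 h.ge h.le]; simp only [Face.side, eastRayB, w42, decide_eq_true_eq]; omega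
  · rw [rowFace_D (by omega) h.le, rowOut_D0 h.ge h.le]; simp only [Face.side, eastRayB, w42, decide_eq_true_eq]; omega
  · rw [rowFace_E (by omega) h.le, rowOut_E0 h.ge h.le]; simp only [Face.side, eastRayB, Bool.false_eq_true, false_iff]; omega
  · rw [rowFace_F h1, rowOut_F0 h1 h2]; simp only [Face.side, eastRayB, Bool.false_eq_true, false_iff]; omega
  · rw [rowFace_F (k := k) (i := m) (by omega), rowOut_F1 (k := k) (i := m) (by omega)]
    simp only [Face.side, eastRayB, w42, decide_eq_true_eq]; omega

/-- ★ **FIRST HIT `k`**: the parametric witness first touches `r` with its `k`-th mid-edge, the `W` side of `r` (end of the initial straight run).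
[cite: Glazman2015WeightedSAW, Lemma 3.1 (proof, pp. 6–7)] -/
theorem firstHitG_rowWalkP : (rowWalkP k).firstHitG = k := by
  refine YBWalk.firstHitG_eq_of_nth _ (by rw [rowWalkP_length]; omega) (s := .W) ?_ fun i hi t => ?_
  · rw [rowWalkP_nth (by omega), YBWalk.pathMid_eq_side_in rowFace_glue (by omega), rowFace_A le_rfl, rowIn_A le_rfl]
  · rw [rowWalkP_nth (by omega), YBWalk.pathMid_eq_side_in rowFace_glue (by omega), rowFace_A hi.le, rowIn_A hi.le]
    cases t <;> simp only [Face.side, ne_eq, MidEdge.vert.injEq, reduceCtorEq, not_false_eq_true] <;> omega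

/-- No later arc of the parametric witness lies in `r` (class `B2a`). [cite: Glazman2015WeightedSAW, Lemma 3.1 (proof, pp. 6–7)] -/
theorem rowWalkP_fc_ne {j : ℕ} (hj1 : k < j) (hj2 : j < 3 * k + 8) : (rowWalkP k).fc j ≠ (((4 : ℤ) + k, (2 : ℤ)) : Face) := by
  rw [(rowWalkP_fc_sIn_sOut hj2).1, ← rowFace_A (k := k) (i := k) le_rfl]
  intro h
  exact absurd (rowFace_injective j k hj2 (by omega) h) (by omega)

/-- ★ **ONE mid-edge on the eastern ray of the hole** (odd ray count ⇒ wound). [cite: CourantRobbins1958, Ch. V Appendix §2 (the even–odd rule)] -/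
theorem rowWalkP_ray_card : ((Finset.range (2 * k + 8)).filter fun j => eastRayB w42 ((rowWalkP k).nth (k + j + 1)) = true).card = 1 := by
  have e : ((Finset.range (2 * k + 8)).filter fun j => eastRayB w42 ((rowWalkP k).nth (k + j + 1)) = true) = {2 * k + 7} := by
    ext j
    simp only [Finset.mem_filter, Finset.mem_range, Finset.mem_singleton]
    constructor
    · rintro ⟨hj, h⟩
      rw [rowWalkP_nth (by omega), YBWalk.pathMid_succ, rowRay_iff (by omega)] at h; omega
    · intro h
      refine ⟨by omega, ?_⟩
      rw [rowWalkP_nth (by omega), YBWalk.pathMid_succ, rowRay_iff (by omega)]; omega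
  rw [e, Finset.card_singleton]

/-- ★★ **THE CERTIFICATES OF THE PARAMETRIC ROOT-ROW WITNESS**: first hit `k`, `3k + 8` arcs, no later arc in the rhombus, ONE eastern-ray crossing, limit cost `5`.
[cite: Glazman2015WeightedSAW, Lemma 3.1 (proof, pp. 6–7)] [cite: CourantRobbins1958, Ch. V Appendix §2 (the even–odd rule)] [cite: GlazmanManolescu2019, §1, eq. (1); Remark 2.2] -/
theorem ωRP_cert : (ωRP k).2.firstHitG = k ∧ (ωRP k).2.arcs.length = 3 * k + 8 ∧ (∀ j < 3 * k + 8, k < j → (ωRP k).2.fc j ≠ (((4 : ℤ) + k, (2 : ℤ)) : Face)) ∧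
    ((Finset.range (2 * k + 8)).filter fun j => eastRayB w42 ((ωRP k).2.nth (k + j + 1)) = true).card = 1 ∧ cost (slotOfSide (ωRP k).1) (ωRP k).2.mids = 5 :=
  ⟨firstHitG_rowWalkP, rowWalkP_length, fun _ hj2 hj1 => rowWalkP_fc_ne hj1 hj2, rowWalkP_ray_card, cost_rowWalkP⟩

end Reference

/-! ## §3 Every position: the root-row law at every cell -/

section Translate

variable {Dl : List Face} {w : Face} {k : ℕ}

/-- The frame of the root-row witness `k` at the root plaquette `w`: the translate of `rowFrame42 k`. [cite: GlazmanManolescu2019, §2.1, §4.2 (translation invariance)] -/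
def rowFrame (w : Face) (k : ℕ) : List Face := (rowFrame42 k).map (Face.shiftBy (refShift w))

/-- The parametric reference witness, placed in the back-translated list containing its frame: class `B2a`, odd eastern-ray count, limit cost `5`.
[cite: Glazman2015WeightedSAW, Lemma 3.1 (proof, pp. 6–7)] [cite: CourantRobbins1958, Ch. V Appendix §2 (the even–odd rule)] -/
theorem refWitnessRP (hB₀ : ∀ c ∈ rowFrame42 k, c ∈ Dl.map (Face.shiftBy (-refShift w))) :
    ∃ (ω₀ : ΩG (dom (Dl.map (Face.shiftBy (-refShift w)))) (w42.side .W) (((4 : ℤ) + k, (2 : ℤ)) : Face)) (_ : ω₀.IsB2a),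
      Odd ((Finset.range ω₀.Mv).filter fun j => eastRayB w42 (ω₀.2.nth (ω₀.2.firstHitG + j + 1)) = true).card ∧
      cost (slotOfSide ω₀.1) ω₀.2.mids = 5 := by
  obtain ⟨hF, hn, hfc, hodd, hc⟩ := ωRP_cert (k := k)
  let ω₀ : ΩG (dom (Dl.map (Face.shiftBy (-refShift w)))) (w42.side .W) (((4 : ℤ) + k, (2 : ℤ)) : Face) :=
    ⟨.S, (rowWalkP k).mapDomain fun c hc => hB₀ c hc⟩
  have hF' : ω₀.2.firstHitG = k := hF
  have hn' : ω₀.2.arcs.length = 3 * k + 8 := hn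
  have h₀ : ω₀.IsB2a := by
    refine ΩG.isB2a_of_forall_fc_ne (by rw [hF', hn']; omega) fun j hj1 hj2 => ?_
    rw [hF'] at hj1; rw [hn'] at hj2
    exact hfc j hj2 hj1
  have hM : ω₀.Mv = 2 * k + 8 := by unfold ΩG.Mv; rw [hF', hn']; omega
  refine ⟨ω₀, h₀, ?_, hc⟩
  rw [hM, hF', show ((Finset.range (2 * k + 8)).filter fun j => eastRayB w42 (ω₀.2.nth (k + j + 1)) = true).card = 1 from hodd]
  exact odd_one

/-- ★★★★ **A WOUND COST-`5` MEMBER AT EVERY ROOT-ROW RHOMBUS EAST OF THE ROOT, EVERY POSITION** (`k ≥ 0`): every face list containing the frame `rowFrame w k` carries a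
class-`B2a` walk at `(w.1 + k, w.2)` from the root `w.side W` that is WOUND (`A_J ≠ 0`) and of limit cost `5` — the hypothesis `hex` of the root-row law, for all `k`.
[cite: GlazmanManolescu2019, §4.2 (translation invariance), Lemma 2.1; §1 eq. (1)] [cite: Glazman2015WeightedSAW, Lemma 3.1 (proof, pp. 6–7)]
[cite: CourantRobbins1958, Ch. V Appendix §2 (the even–odd rule)] -/
theorem exists_wound_cost_five_of_rowFrame (hB : ∀ c ∈ rowFrame w k, c ∈ Dl) (hr : RootedFace (dom Dl) (w.side .W) (w.1 + k, w.2)) :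
    ∃ (ω : ΩG (dom Dl) (w.side .W) (w.1 + k, w.2)) (h : ω.IsB2a), ω.AJ hr h (toC (midPt (w.side .W))) ≠ 0 ∧ cost (slotOfSide ω.1) ω.2.mids = 5 := by
  have hB₀ := block42_mem_of_block_mem (B := rowFrame42 k) hB
  have hrr : Face.shiftBy (refShift w) ((((4 : ℤ) + k, (2 : ℤ))) : Face) = (w.1 + k, w.2) := shiftBy_refShift_rootRow w k
  obtain ⟨ω₀, h₀, hodd, hc⟩ := refWitnessRP hB₀
  exact ΩG.exists_wound_cost_five_shift (shiftBy_refShift_root w) hrr hr (rootedFace_refShift_back' (shiftBy_refShift_root w) hrr hr) ω₀ h₀ hodd hc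

/-- ★★★★★ **THE ROOT-ROW LAW AT EVERY CELL.** For EVERY `k ≥ 0` and every finite face list `Dl` missing the hole `(w.1 − 1, w.2)` and containing the frame `rowFrame w k`,
the printed Yang–Baxter vertex functional at the root `w.side W` and the root-row rhombus `(w.1 + k, w.2)` has finitely many zeros in `(0, π)`, at most `4·maxExp − 4`.
[cite: GlazmanManolescu2019, Lemma 2.1 and eq. (1); Remark 2.2; §4.2] [cite: Glazman2015WeightedSAW, Lemma 3.1 (proof, pp. 6–7)] -/
theorem vertexFunctional_printed_zero_set_finite_of_rowFrame (hh : holeFaceW w ∉ dom Dl) (hB : ∀ c ∈ rowFrame w k, c ∈ Dl)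
    (hr : RootedFace (dom Dl) (w.side .W) (w.1 + k, w.2)) :
    {θ ∈ Set.Ioo 0 π | vertexFunctional (printedWeights θ) tFiveEighths (ybCoeff θ) Dl (w.side .W) (w.1 + k, w.2) = 0}.Finite ∧
      {θ ∈ Set.Ioo 0 π | vertexFunctional (printedWeights θ) tFiveEighths (ybCoeff θ) Dl (w.side .W) (w.1 + k, w.2) = 0}.ncard ≤
        4 * maxExp Dl (w.side .W) (w.1 + k, w.2) + 1 - 5 := by
  obtain ⟨ω, h, hA, hc⟩ := exists_wound_cost_five_of_rowFrame hB hr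
  exact vertexFunctional_printed_zero_set_finite_of_rootRow Dl hh hr rfl (by simp only; omega) ⟨ω, h, hA, hc⟩

/-- ★★★★★ **NOT IDENTICALLY ZERO AT EVERY CELL OF THE ROOT ROW EAST OF THE ROOT**: under the same hypotheses some `θ ∈ (0, π)` has `VF_D(w.side W, (w.1 + k, w.2); θ) ≠ 0`.
[cite: GlazmanManolescu2019, Lemma 2.1 and eq. (1); Remark 2.2; §4.2] [cite: Glazman2015WeightedSAW, Lemma 3.1 (proof, pp. 6–7)] -/
theorem vertexFunctional_printed_exists_ne_zero_of_rowFrame (hh : holeFaceW w ∉ dom Dl) (hB : ∀ c ∈ rowFrame w k, c ∈ Dl)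
    (hr : RootedFace (dom Dl) (w.side .W) (w.1 + k, w.2)) :
    ∃ θ ∈ Set.Ioo 0 π, vertexFunctional (printedWeights θ) tFiveEighths (ybCoeff θ) Dl (w.side .W) (w.1 + k, w.2) ≠ 0 := by
  obtain ⟨ω, h, hA, hc⟩ := exists_wound_cost_five_of_rowFrame hB hr
  exact vertexFunctional_printed_exists_ne_zero_of_rootRow Dl hh hr rfl (by simp only; omega) ⟨ω, h, hA, hc⟩

end Translate

end Literature.Barriers.CriticalPhenomena.PlaquetteWalk
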